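import Summits.NavierStokesRegularity.NavierStokesRegularity.Theorems.OddMorawetzLocal.Negative.OddMorawetzLocalSymmetryDefs
import Summits.NavierStokesRegularity.NavierStokesRegularity.Theorems.OddMorawetzDefs

/-!
# Route OddMorawetz — coordinates and bases on the space of 3-jets (definitions)

Vocabulary for the finite-dimensional algebra behind the two cruxes `MorawetzKillsTypeI` (stmt-1377) and
`OddMorawetzLocal` (stmt-1376): both reduce to the statement that no `O(3)`-invariant cubic density of derivative
weight `k ∈ {3, 5}` on 3-jets `z = (z₀, z₁, z₂, z₃) ∈ Jet3` (value, first, second, third derivative of a vector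
field on `ℝ³`) has a one-signed Euler derivative; the proof expands such densities in COORDINATES and runs explicit
linear algebra (structure theorems, null-Lagrangian certificates, exact values). This file fixes, once, the
coordinate system used by all those files:

* `jcU a`, `jcA a b`, `jcH a b c`, `jcT a b c d : Jet3 →L[ℝ] ℝ` — the coordinates `u_a`, `∂_b u_a`, `∂_b∂_c u_a`,
  `∂_b∂_c∂_d u_a` of a jet (for `z = (v x, Dv x, D²v x, D³v x)`: `jcA a b z = Dv(x) e_b · e_a`, etc.), as CONTINUOUS
  LINEAR functionals (so that polynomial densities are manifestly smooth and their derivatives are computed by the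
  product rule);
* `jbasis n c J : E3 [×n]→L[ℝ] E3` — the basis multilinear map `h ↦ (∏ₛ h_s (J s)) e_c` of `stub_cubicJetExpansion` /
  `stub_signedPermBasis`, and `jbsum n c J = ∑_{π ∈ 𝔖ₙ} jbasis n c (J ∘ π)`, its (un-normalised) symmetrisation, in which
  SYMMETRIC multilinear maps (the jets of smooth fields) expand with coefficients `(Z (e ∘ J))_c / n!`;
* `jshift i z : Jet3` — the formal `∂ᵢ`-shift of a jet, `(z₁ eᵢ, z₂(eᵢ, ·), z₃(eᵢ, ·, ·), 0)`: for `z = J v (x)` its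
  first three components are those of `∂ᵢ (J v)(x)` (Mathlib `fderiv_iteratedFDeriv`: `∂_h Dⁿv = Dⁿ⁺¹v (h, ·)`), which is
  all a flux depending on jets of order `≤ 2` sees — so total divergences of such fluxes are computed inside `Jet3`.

Design: plain `def`s over Mathlib notions (`EuclideanSpace.proj/single`, `ContinuousMultilinearMap.apply/mkPiRing/
compContinuousLinearMap/curryLeft`) and the tree's `Jet3` (`OddMorawetzLocalSymmetryDefs`); only `rfl`-level unfolding
lemmas are proved here. Nothing restates a tree notion (`lean search` 2026-08-17: no jet-coordinate vocabulary in
`Literature`/`Summits`; `jetAct`/`mlAct`/`signedPerm` of the 1376 line are reused, not redefined).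
-/

noncomputable section

open scoped BigOperators

-- the problem namespace `Summit.NavierStokesRegularity.NavierStokesRegularity` repeats the summit name by design (D-0017)
set_option linter.dupNamespace false

namespace Summit.NavierStokesRegularity.NavierStokesRegularity.Theorems.OddMorawetz

/-! ### Coordinates -/

/-- The coordinate `u_a` of a 3-jet: `z ↦ (z₀)_a`. -/
def jcU (a : Fin 3) : Jet3 →L[ℝ] ℝ :=
  (EuclideanSpace.proj a).comp (ContinuousLinearMap.fst ℝ E3 _)

/-- The coordinate `A_{ab} = ∂_b u_a` of a 3-jet: `z ↦ (z₁ e_b)_a`. -/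
def jcA (a b : Fin 3) : Jet3 →L[ℝ] ℝ :=
  (EuclideanSpace.proj a).comp
    ((ContinuousMultilinearMap.apply ℝ (fun _ : Fin 1 => E3) E3 (fun _ => EuclideanSpace.single b (1 : ℝ))).comp
      ((ContinuousLinearMap.fst ℝ (E3 [×1]→L[ℝ] E3) _).comp (ContinuousLinearMap.snd ℝ E3 _)))

/-- The coordinate `H_{abc} = ∂_b∂_c u_a` of a 3-jet: `z ↦ (z₂ (e_b, e_c))_a`. -/
def jcH (a b c : Fin 3) : Jet3 →L[ℝ] ℝ :=
  (EuclideanSpace.proj a).comp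
    ((ContinuousMultilinearMap.apply ℝ (fun _ : Fin 2 => E3) E3
        ![EuclideanSpace.single b (1 : ℝ), EuclideanSpace.single c (1 : ℝ)]).comp
      ((ContinuousLinearMap.fst ℝ (E3 [×2]→L[ℝ] E3) _).comp
        ((ContinuousLinearMap.snd ℝ (E3 [×1]→L[ℝ] E3) _).comp (ContinuousLinearMap.snd ℝ E3 _))))

/-- The coordinate `T_{abcd} = ∂_b∂_c∂_d u_a` of a 3-jet: `z ↦ (z₃ (e_b, e_c, e_d))_a`. -/
def jcT (a b c d : Fin 3) : Jet3 →L[ℝ] ℝ :=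
  (EuclideanSpace.proj a).comp
    ((ContinuousMultilinearMap.apply ℝ (fun _ : Fin 3 => E3) E3
        ![EuclideanSpace.single b (1 : ℝ), EuclideanSpace.single c (1 : ℝ), EuclideanSpace.single d (1 : ℝ)]).comp
      ((ContinuousLinearMap.snd ℝ (E3 [×2]→L[ℝ] E3) _).comp
        ((ContinuousLinearMap.snd ℝ (E3 [×1]→L[ℝ] E3) _).comp (ContinuousLinearMap.snd ℝ E3 _))))

/-- `jcU a z = (z₀)_a`. -/
@[simp] theorem jcU_apply (a : Fin 3) (z : Jet3) : jcU a z = z.1 a := rfl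

/-- `jcA a b z = (z₁ e_b)_a`. -/
@[simp] theorem jcA_apply (a b : Fin 3) (z : Jet3) :
    jcA a b z = z.2.1 (fun _ => EuclideanSpace.single b (1 : ℝ)) a := rfl

/-- `jcH a b c z = (z₂ (e_b, e_c))_a`. -/
@[simp] theorem jcH_apply (a b c : Fin 3) (z : Jet3) :
    jcH a b c z = z.2.2.1 ![EuclideanSpace.single b (1 : ℝ), EuclideanSpace.single c (1 : ℝ)] a := rfl

/-- `jcT a b c d z = (z₃ (e_b, e_c, e_d))_a`. -/
@[simp] theorem jcT_apply (a b c d : Fin 3) (z : Jet3) :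
    jcT a b c d z = z.2.2.2 ![EuclideanSpace.single b (1 : ℝ), EuclideanSpace.single c (1 : ℝ),
      EuclideanSpace.single d (1 : ℝ)] a := rfl

/-! ### Basis multilinear maps and their symmetrisations -/

/-- The basis `n`-multilinear map `h ↦ (∏ₛ h_s (J s)) • e_c` of `ℝ³ × ⋯ × ℝ³ → ℝ³` (the dual basis of the coordinates:
`(jbasis n c J) (e ∘ J')` has `c`-component `1` if `J' = J` and all components `0` otherwise). -/
def jbasis (n : ℕ) (c : Fin 3) (J : Fin n → Fin 3) : E3 [×n]→L[ℝ] E3 :=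
  (ContinuousMultilinearMap.mkPiRing ℝ (Fin n) (EuclideanSpace.single c (1 : ℝ))).compContinuousLinearMap
    fun s => EuclideanSpace.proj (J s)

/-- The un-normalised symmetrisation `∑_{π ∈ 𝔖ₙ} jbasis n c (J ∘ π)` of a basis multilinear map: a SYMMETRIC
`n`-multilinear map `Z` expands as `Z = ∑_c ∑_J ((Z (e ∘ J))_c / n!) • jbsum n c J`. -/
def jbsum (n : ℕ) (c : Fin 3) (J : Fin n → Fin 3) : E3 [×n]→L[ℝ] E3 :=
  ∑ π : Equiv.Perm (Fin n), jbasis n c (J ∘ π)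

/-- `jbasis` applied: `(∏ₛ h_s (J s)) • e_c`. -/
theorem jbasis_apply :
    ∀ (n : ℕ) (c : Fin 3) (J : Fin n → Fin 3) (h : Fin n → E3), jbasis n c J h = (∏ s, h s (J s)) • EuclideanSpace.single c (1 : ℝ) := by
  intro n c J h
  simp [jbasis, ContinuousMultilinearMap.compContinuousLinearMap_apply, ContinuousMultilinearMap.mkPiRing_apply]

/-- `jbsum` unfolded. -/
theorem jbsum_def (n : ℕ) (c : Fin 3) (J : Fin n → Fin 3) :
    jbsum n c J = ∑ π : Equiv.Perm (Fin n), jbasis n c (J ∘ π) := rfl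

/-! ### The formal shift of a jet -/

/-- The formal `∂ᵢ`-shift of a 3-jet: `jshift i (z₀, z₁, z₂, z₃) = (z₁ eᵢ, z₂(eᵢ, ·), z₃(eᵢ, ·, ·), 0)`. For the jet
`z = (v x, Dv x, D²v x, D³v x)` of a smooth field, the first three components are those of the derivative of
`y ↦ (v y, Dv y, D²v y, D³v y)` at `x` along `eᵢ` (the last one would be `D⁴v x (eᵢ, ·, ·, ·)`, outside `Jet3`). -/
def jshift (i : Fin 3) (z : Jet3) : Jet3 :=
  (z.2.1 (fun _ => EuclideanSpace.single i (1 : ℝ)),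
    z.2.2.1.curryLeft (EuclideanSpace.single i (1 : ℝ)),
    z.2.2.2.curryLeft (EuclideanSpace.single i (1 : ℝ)), 0)

/-- First component of the shift. -/
@[simp] theorem jshift_fst (i : Fin 3) (z : Jet3) :
    (jshift i z).1 = z.2.1 (fun _ => EuclideanSpace.single i (1 : ℝ)) := rfl

/-- Second component of the shift, applied. -/
@[simp] theorem jshift_snd_fst_apply (i : Fin 3) (z : Jet3) (h : Fin 1 → E3) :
    (jshift i z).2.1 h = z.2.2.1 (Fin.cons (EuclideanSpace.single i (1 : ℝ)) h) := rfl

/-- Third component of the shift, applied. -/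
@[simp] theorem jshift_snd_snd_fst_apply (i : Fin 3) (z : Jet3) (h : Fin 2 → E3) :
    (jshift i z).2.2.1 h = z.2.2.2 (Fin.cons (EuclideanSpace.single i (1 : ℝ)) h) := rfl

/-- Fourth component of the shift (zero by convention). -/
@[simp] theorem jshift_snd_snd_snd (i : Fin 3) (z : Jet3) : (jshift i z).2.2.2 = 0 := rfl

end Summit.NavierStokesRegularity.NavierStokesRegularity.Theorems.OddMorawetz

end
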